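import Summits.HodgeConjecture.HodgeConjecture.Theorems.HodgeLocusCensusJoinStackCert
import HarnessLib

/-!
# HodgeLocusCensusJoinStackRank6 — a valid Kronecker stacked certificate decides rank [M_{δ₁} ; M_{δ₂}] of two fully twisted plane sums on the Fermat quartic SIXFOLD (cell pub-hlocus, LEAD gen 5, (T40))
HONEST FRAMING: certified instances and evidence bearing on the general Hodge conjecture; no claim.

MAIN THEOREM `ivhsJoinStackRankEq_of_cert6`: for 4-twist classes L1, L2 (signed planes plane64 a₁ a₃ a₅ a₇), a Kronecker stacked certificate Ψ
(`HodgeLocusCensusJoinStackCert.KronCert`) with `Ψ.valid L1 L2 = true` and a type-major enumeration of the r modes (`modeK`, `off`, H1–H3 over the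
19 types of `HodgeLocusCensusPlaneRank6`, heads = all four pairs), rank (fromRows M_{δ₁} M_{δ₂}) = r for δ_i = planeList6q L_i, over every field of
characteristic 0 and every primitive 8th root ζ. Upper bound: [M₁ ; M₂] = [U⁰ ; U¹] · V through K^r (each layer factors through the SAME right
factor V by the evaluated factorisation `KronCert.factor_eq_eval`; `Matrix.fromRows_mul`). Lower bound: the r × r minor on the pivot rows
ρ(m) = (layer ; h ; σ − h) ∈ I ⊕ I and pivot columns γ(m) is (lower triangular, nonzero diagonal) · (upper triangular, nonzero diagonal) by
`KronCert.A_upper_zero / B_lower_zero / pivots`. Shape of the argument as in `HodgeLocusCensusPlaneSumStackRank4`, with four head pairs.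
-/

namespace Summit.HodgeConjecture.HodgeConjecture.HodgeLocus.Census.PlaneSum

open TwistCells PlaneRank6

section cert

variable {K : Type*} [Field K] (ζ : K) (L1 L2 : List (ℤ × ℕ × ℕ × ℕ × ℕ)) (Ψ : KronCert) {r : ℕ} (modeK : Fin r → Fin 19) (off : Fin 19 → ℕ)

/-- left factor of layer `lay`: U^{lay}[i, m] = [type(i) = type(m)] · A_{σ}[(lay, head(i)), ℓ(m)](ζ). -/
noncomputable def JU6 (lay : ℕ) : Matrix (indexSet 6 4 (6 / 2 * 4 - 6 - 2)) (Fin r) K := fun i m =>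
  if i.1 0 + i.1 1 = sig0 (modeK m) ∧ i.1 2 + i.1 3 = sig1 (modeK m) ∧ i.1 4 + i.1 5 = sig2 (modeK m) ∧ i.1 6 + i.1 7 = sig3 (modeK m) then
    Z8.eval ζ (Ψ.A (sig0 (modeK m)) (sig1 (modeK m)) (sig2 (modeK m)) (sig3 (modeK m)) lay (i.1 0) (i.1 2) (i.1 4) (i.1 6) (m.1 - off (modeK m))) else 0

/-- common right factor: V[m, j] = [type(j) complementary to type(m)] · B_{σ}[ℓ(m), head(j)](ζ). -/
noncomputable def JV6 : Matrix (Fin r) (indexSet 6 4 4) K := fun m j =>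
  if sig0 (modeK m) + (j.1 0 + j.1 1) = 2 ∧ sig1 (modeK m) + (j.1 2 + j.1 3) = 2 ∧ sig2 (modeK m) + (j.1 4 + j.1 5) = 2 ∧
      sig3 (modeK m) + (j.1 6 + j.1 7) = 2 then
    Z8.eval ζ (Ψ.B (sig0 (modeK m)) (sig1 (modeK m)) (sig2 (modeK m)) (sig3 (modeK m)) (m.1 - off (modeK m)) (j.1 0) (j.1 2) (j.1 4) (j.1 6)) else 0

/-- ENTRY FORMULA of M_δ for a 4-twist class δ = planeList6q L. -/
theorem ivhsMatrix_planeList6q_apply (L : List (ℤ × ℕ × ℕ × ℕ × ℕ)) (h4 : ζ ^ 4 = -1) (i : indexSet 6 4 (6 / 2 * 4 - 6 - 2)) (j : indexSet 6 4 4) :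
    ivhsMatrix 6 4 ζ (planeList6q L) i j =
      if i.1 0 + j.1 0 + (i.1 1 + j.1 1) = 2 ∧ i.1 2 + j.1 2 + (i.1 3 + j.1 3) = 2 ∧ i.1 4 + j.1 4 + (i.1 5 + j.1 5) = 2 ∧
          i.1 6 + j.1 6 + (i.1 7 + j.1 7) = 2 then
        Z8.eval ζ (qcore L (i.1 0 + j.1 0) (i.1 2 + j.1 2) (i.1 4 + j.1 4) (i.1 6 + j.1 6)) else 0 := by
  unfold ivhsMatrix
  rw [periodComb_planeList6q ζ h4]

/-- STRUCTURE THEOREM per layer: M_{δ_lay} = U^{lay} · V through K^r. -/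
theorem ivhsMatrix_qlayer6_eq_mul (h4 : ζ ^ 4 = -1) (hV : Ψ.valid L1 L2 = true) {lay : ℕ} (hlay : lay < 2)
    (H1 : ∀ m : Fin r, off (modeK m) ≤ m.1 ∧ m.1 < off (modeK m) + krs6 Ψ (modeK m)) (H2 : ∀ k : Fin 19, off k + krs6 Ψ k ≤ r)
    (H3 : ∀ m : Fin r, ∀ k : Fin 19, off k ≤ m.1 → m.1 < off k + krs6 Ψ k → modeK m = k) :
    ivhsMatrix 6 4 ζ (planeList6q (qlayer L1 L2 lay)) = JU6 ζ Ψ modeK off lay * JV6 ζ Ψ modeK off := by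
  ext i j
  rw [Matrix.mul_apply, ivhsMatrix_planeList6q_apply ζ (qlayer L1 L2 lay) h4]
  by_cases hex : ∃ k : Fin 19, i.1 0 + i.1 1 = sig0 k ∧ i.1 2 + i.1 3 = sig1 k ∧ i.1 4 + i.1 5 = sig2 k ∧ i.1 6 + i.1 7 = sig3 k
  · obtain ⟨k₀, h0, h1, h2, h3⟩ := hex
    obtain ⟨l0, l1, l2, l3⟩ := sig_le k₀
    have hU : ∀ m : Fin r, modeK m ≠ k₀ → JU6 ζ Ψ modeK off lay i m = 0 := by
      intro m hm
      unfold JU6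
      rw [if_neg]
      intro h
      exact hm (sig_inj _ _ (h.1.symm.trans h0) (h.2.1.symm.trans h1) (h.2.2.1.symm.trans h2) (h.2.2.2.symm.trans h3))
    by_cases hc : sig0 k₀ + (j.1 0 + j.1 1) = 2 ∧ sig1 k₀ + (j.1 2 + j.1 3) = 2 ∧ sig2 k₀ + (j.1 4 + j.1 5) = 2 ∧ sig3 k₀ + (j.1 6 + j.1 7) = 2
    · rw [if_pos ⟨by omega, by omega, by omega, by omega⟩]
      set g : ℕ → K := fun ℓ => Z8.eval ζ (Ψ.A (sig0 k₀) (sig1 k₀) (sig2 k₀) (sig3 k₀) lay (i.1 0) (i.1 2) (i.1 4) (i.1 6) ℓ) *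
        (Z8.eval ζ (Ψ.B (sig0 k₀) (sig1 k₀) (sig2 k₀) (sig3 k₀) ℓ (j.1 0) (j.1 2) (j.1 4) (j.1 6))) with hg
      have hterm : ∀ m : Fin r, JU6 ζ Ψ modeK off lay i m * JV6 ζ Ψ modeK off m j = if modeK m = k₀ then g (m.1 - off k₀) else 0 := by
        intro m
        by_cases hm : modeK m = k₀
        · rw [if_pos hm, hg]
          unfold JU6 JV6
          rw [hm, if_pos ⟨h0, h1, h2, h3⟩, if_pos hc]
        · rw [if_neg hm, hU m hm, zero_mul]
      rw [Finset.sum_congr rfl fun m _ => hterm m, sum_modes modeK off (krs6 Ψ) H1 H2 H3 k₀ g, hg,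
        ← KronCert.factor_eq_eval ζ h4 hV (s0 := sig0 k₀) (s1 := sig1 k₀) (s2 := sig2 k₀) (s3 := sig3 k₀) (lay := lay) (a := i.1 0) (b := i.1 2)
          (c := i.1 4) (d := i.1 6) (a' := j.1 0) (b' := j.1 2) (c' := j.1 4) (d' := j.1 6) (by omega) (by omega) (by omega) (by omega) hlay
          (by omega) (by omega) (by omega) (by omega) (by omega) (by omega) (by omega) (by omega)]
    · rw [if_neg fun h => hc ⟨by omega, by omega, by omega, by omega⟩]
      symm
      refine Finset.sum_eq_zero fun m _ => ?_
      by_cases hm : modeK m = k₀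
      · unfold JV6
        rw [hm, if_neg hc, mul_zero]
      · rw [hU m hm, zero_mul]
  · -- a row with some pair sum > 2 (no type): both sides vanish
    have hsum : i.1 0 + i.1 1 + i.1 2 + i.1 3 + i.1 4 + i.1 5 + i.1 6 + i.1 7 = 4 := by
      have h := (Finset.mem_filter.mp i.2).2
      rw [Fin.sum_univ_eight] at h
      exact h
    have hU : ∀ m : Fin r, JU6 ζ Ψ modeK off lay i m = 0 := fun m => by
      unfold JU6
      exact if_neg fun h => hex ⟨modeK m, h⟩
    rw [Finset.sum_eq_zero fun m _ => by rw [hU m, zero_mul], if_neg]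
    intro hc
    obtain ⟨c0, c1, c2, c3⟩ := hc
    exact hex (sig_cover' (i.1 0 + i.1 1) (i.1 2 + i.1 3) (i.1 4 + i.1 5) (i.1 6 + i.1 7) (by omega) (by omega) (by omega) (by omega)
      (by omega))

/-- STRUCTURE THEOREM, stacked: [M_{δ₁} ; M_{δ₂}] = [U⁰ ; U¹] · V. -/
theorem ivhsMatrix_jstack6_eq_mul (h4 : ζ ^ 4 = -1) (hV : Ψ.valid L1 L2 = true)
    (H1 : ∀ m : Fin r, off (modeK m) ≤ m.1 ∧ m.1 < off (modeK m) + krs6 Ψ (modeK m)) (H2 : ∀ k : Fin 19, off k + krs6 Ψ k ≤ r)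
    (H3 : ∀ m : Fin r, ∀ k : Fin 19, off k ≤ m.1 → m.1 < off k + krs6 Ψ k → modeK m = k) :
    Matrix.fromRows (ivhsMatrix 6 4 ζ (planeList6q L1)) (ivhsMatrix 6 4 ζ (planeList6q L2)) =
      Matrix.fromRows (JU6 ζ Ψ modeK off 0) (JU6 ζ Ψ modeK off 1) * JV6 ζ Ψ modeK off := by
  rw [Matrix.fromRows_mul, ← ivhsMatrix_qlayer6_eq_mul ζ L1 L2 Ψ modeK off h4 hV (lay := 0) (by omega) H1 H2 H3,
    ← ivhsMatrix_qlayer6_eq_mul ζ L1 L2 Ψ modeK off h4 hV (lay := 1) (by omega) H1 H2 H3, qlayer_zero, qlayer_one]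

/-- UPPER BOUND: rank [M_{δ₁} ; M_{δ₂}] ≤ r. -/
theorem jstackRank_le_of_cert6 (h4 : ζ ^ 4 = -1) (hV : Ψ.valid L1 L2 = true)
    (H1 : ∀ m : Fin r, off (modeK m) ≤ m.1 ∧ m.1 < off (modeK m) + krs6 Ψ (modeK m)) (H2 : ∀ k : Fin 19, off k + krs6 Ψ k ≤ r)
    (H3 : ∀ m : Fin r, ∀ k : Fin 19, off k ≤ m.1 → m.1 < off k + krs6 Ψ k → modeK m = k) :
    (Matrix.fromRows (ivhsMatrix 6 4 ζ (planeList6q L1)) (ivhsMatrix 6 4 ζ (planeList6q L2))).rank ≤ r := by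
  rw [ivhsMatrix_jstack6_eq_mul ζ L1 L2 Ψ modeK off h4 hV H1 H2 H3]
  exact (Matrix.rank_mul_le_left _ _).trans
    (by simpa using Matrix.rank_le_card_width (Matrix.fromRows (JU6 ζ Ψ modeK off 0) (JU6 ζ Ψ modeK off 1)))

/-! ### pivot rows and columns with four heads -/

/-- the row (h₀, σ₀−h₀, …, h₃, σ₃−h₃) of type k with head h … -/
def mkRowQ6 (k : Fin 19) (h : ℕ × ℕ × ℕ × ℕ) : Fin 8 → ℕ :=
  ![h.1, sig0 k - h.1, h.2.1, sig1 k - h.2.1, h.2.2.1, sig2 k - h.2.2.1, h.2.2.2, sig3 k - h.2.2.2]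
/-- … and the column (g₀, 2−σ₀−g₀, …, g₃, 2−σ₃−g₃) of the complementary type with head g. -/
def mkColQ6 (k : Fin 19) (g : ℕ × ℕ × ℕ × ℕ) : Fin 8 → ℕ :=
  ![g.1, 2 - sig0 k - g.1, g.2.1, 2 - sig1 k - g.2.1, g.2.2.1, 2 - sig2 k - g.2.2.1, g.2.2.2, 2 - sig3 k - g.2.2.2]

/-- the pivot rows lie in I_{d−2} … -/
theorem mkRowQ6_mem (k : Fin 19) (h : ℕ × ℕ × ℕ × ℕ) (hb : h.1 ≤ sig0 k ∧ h.2.1 ≤ sig1 k ∧ h.2.2.1 ≤ sig2 k ∧ h.2.2.2 ≤ sig3 k) :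
    mkRowQ6 k h ∈ indexSet 6 4 (6 / 2 * 4 - 6 - 2) := by
  obtain ⟨l0, l1, l2, l3⟩ := sig_le k
  have hs := sig_sum k
  unfold indexSet
  simp only [Finset.mem_filter, Fintype.mem_piFinset, Finset.mem_range, Fin.forall_fin_succ, Fin.sum_univ_succ]
  simp [mkRowQ6]
  omega

/-- … and the pivot columns in I_d. -/
theorem mkColQ6_mem (k : Fin 19) (g : ℕ × ℕ × ℕ × ℕ) (hb : g.1 ≤ 2 - sig0 k ∧ g.2.1 ≤ 2 - sig1 k ∧ g.2.2.1 ≤ 2 - sig2 k ∧ g.2.2.2 ≤ 2 - sig3 k) :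
    mkColQ6 k g ∈ indexSet 6 4 4 := by
  obtain ⟨l0, l1, l2, l3⟩ := sig_le k
  have hs := sig_sum k
  unfold indexSet
  simp only [Finset.mem_filter, Fintype.mem_piFinset, Finset.mem_range, Fin.forall_fin_succ, Fin.sum_univ_succ]
  simp [mkColQ6]
  omega

/-- heads and pair sums of a pivot row … -/
theorem mkRowQ6_val (k : Fin 19) (h : ℕ × ℕ × ℕ × ℕ) (hb : h.1 ≤ sig0 k ∧ h.2.1 ≤ sig1 k ∧ h.2.2.1 ≤ sig2 k ∧ h.2.2.2 ≤ sig3 k) :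
    mkRowQ6 k h 0 = h.1 ∧ mkRowQ6 k h 2 = h.2.1 ∧ mkRowQ6 k h 4 = h.2.2.1 ∧ mkRowQ6 k h 6 = h.2.2.2 ∧
    mkRowQ6 k h 0 + mkRowQ6 k h 1 = sig0 k ∧ mkRowQ6 k h 2 + mkRowQ6 k h 3 = sig1 k ∧ mkRowQ6 k h 4 + mkRowQ6 k h 5 = sig2 k ∧
    mkRowQ6 k h 6 + mkRowQ6 k h 7 = sig3 k := by
  simp [mkRowQ6]
  omega

/-- … and of a pivot column. -/
theorem mkColQ6_val (k : Fin 19) (g : ℕ × ℕ × ℕ × ℕ) (hb : g.1 ≤ 2 - sig0 k ∧ g.2.1 ≤ 2 - sig1 k ∧ g.2.2.1 ≤ 2 - sig2 k ∧ g.2.2.2 ≤ 2 - sig3 k) :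
    mkColQ6 k g 0 = g.1 ∧ mkColQ6 k g 2 = g.2.1 ∧ mkColQ6 k g 4 = g.2.2.1 ∧ mkColQ6 k g 6 = g.2.2.2 ∧
    sig0 k + (mkColQ6 k g 0 + mkColQ6 k g 1) = 2 ∧ sig1 k + (mkColQ6 k g 2 + mkColQ6 k g 3) = 2 ∧ sig2 k + (mkColQ6 k g 4 + mkColQ6 k g 5) = 2 ∧
    sig3 k + (mkColQ6 k g 6 + mkColQ6 k g 7) = 2 := by
  obtain ⟨l0, l1, l2, l3⟩ := sig_le k
  simp [mkColQ6]
  omega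

/-! ### the witness minor -/

variable {L1 L2 Ψ modeK off}

/-- ℓ(m) < r_{shape(m)}. -/
theorem jmodeL_lt6 (H1 : ∀ m : Fin r, off (modeK m) ≤ m.1 ∧ m.1 < off (modeK m) + krs6 Ψ (modeK m)) (m : Fin r) :
    m.1 - off (modeK m) < krs6 Ψ (modeK m) := by
  have := H1 m
  omega

/-- the layer and box facts of the pivots of mode m. -/
theorem jpivot_box6 (hV : Ψ.valid L1 L2 = true) (H1 : ∀ m : Fin r, off (modeK m) ≤ m.1 ∧ m.1 < off (modeK m) + krs6 Ψ (modeK m)) (m : Fin r) :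
    (Ψ.rowP (sig0 (modeK m)) (sig1 (modeK m)) (sig2 (modeK m)) (sig3 (modeK m)) (m.1 - off (modeK m))).1 ≤ 1 ∧
    ((Ψ.rowP (sig0 (modeK m)) (sig1 (modeK m)) (sig2 (modeK m)) (sig3 (modeK m)) (m.1 - off (modeK m))).2.1 ≤ sig0 (modeK m) ∧
      (Ψ.rowP (sig0 (modeK m)) (sig1 (modeK m)) (sig2 (modeK m)) (sig3 (modeK m)) (m.1 - off (modeK m))).2.2.1 ≤ sig1 (modeK m) ∧
      (Ψ.rowP (sig0 (modeK m)) (sig1 (modeK m)) (sig2 (modeK m)) (sig3 (modeK m)) (m.1 - off (modeK m))).2.2.2.1 ≤ sig2 (modeK m) ∧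
      (Ψ.rowP (sig0 (modeK m)) (sig1 (modeK m)) (sig2 (modeK m)) (sig3 (modeK m)) (m.1 - off (modeK m))).2.2.2.2 ≤ sig3 (modeK m)) ∧
    ((Ψ.colP (sig0 (modeK m)) (sig1 (modeK m)) (sig2 (modeK m)) (sig3 (modeK m)) (m.1 - off (modeK m))).1 ≤ 2 - sig0 (modeK m) ∧
      (Ψ.colP (sig0 (modeK m)) (sig1 (modeK m)) (sig2 (modeK m)) (sig3 (modeK m)) (m.1 - off (modeK m))).2.1 ≤ 2 - sig1 (modeK m) ∧
      (Ψ.colP (sig0 (modeK m)) (sig1 (modeK m)) (sig2 (modeK m)) (sig3 (modeK m)) (m.1 - off (modeK m))).2.2.1 ≤ 2 - sig2 (modeK m) ∧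
      (Ψ.colP (sig0 (modeK m)) (sig1 (modeK m)) (sig2 (modeK m)) (sig3 (modeK m)) (m.1 - off (modeK m))).2.2.2 ≤ 2 - sig3 (modeK m)) := by
  obtain ⟨l0, l1, l2, l3⟩ := sig_le (modeK m)
  obtain ⟨-, -, hb⟩ := KronCert.pivots hV (by omega) (by omega) (by omega) (by omega) (jmodeL_lt6 H1 m)
  exact ⟨hb.1, ⟨hb.2.1, hb.2.2.1, hb.2.2.2.1, hb.2.2.2.2.1⟩, hb.2.2.2.2.2⟩

/-- the pivot row of mode m inside its layer … -/
def jrow6 (hV : Ψ.valid L1 L2 = true) (H1 : ∀ m : Fin r, off (modeK m) ≤ m.1 ∧ m.1 < off (modeK m) + krs6 Ψ (modeK m)) (m : Fin r) :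
    indexSet 6 4 (6 / 2 * 4 - 6 - 2) :=
  ⟨mkRowQ6 (modeK m) (Ψ.rowP (sig0 (modeK m)) (sig1 (modeK m)) (sig2 (modeK m)) (sig3 (modeK m)) (m.1 - off (modeK m))).2,
    mkRowQ6_mem _ _ (jpivot_box6 hV H1 m).2.1⟩

/-- … placed in its layer of I ⊕ I … -/
def jrho6 (hV : Ψ.valid L1 L2 = true) (H1 : ∀ m : Fin r, off (modeK m) ≤ m.1 ∧ m.1 < off (modeK m) + krs6 Ψ (modeK m)) (m : Fin r) :
    indexSet 6 4 (6 / 2 * 4 - 6 - 2) ⊕ indexSet 6 4 (6 / 2 * 4 - 6 - 2) :=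
  if (Ψ.rowP (sig0 (modeK m)) (sig1 (modeK m)) (sig2 (modeK m)) (sig3 (modeK m)) (m.1 - off (modeK m))).1 = 0 then Sum.inl (jrow6 hV H1 m)
  else Sum.inr (jrow6 hV H1 m)

/-- … and its pivot column. -/
def jgam6 (hV : Ψ.valid L1 L2 = true) (H1 : ∀ m : Fin r, off (modeK m) ≤ m.1 ∧ m.1 < off (modeK m) + krs6 Ψ (modeK m)) (m : Fin r) :
    indexSet 6 4 4 :=
  ⟨mkColQ6 (modeK m) (Ψ.colP (sig0 (modeK m)) (sig1 (modeK m)) (sig2 (modeK m)) (sig3 (modeK m)) (m.1 - off (modeK m))), mkColQ6_mem _ _ (jpivot_box6 hV H1 m).2.2⟩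

/-- heads and pair sums of ρ(m) … -/
theorem jrow6_val (hV : Ψ.valid L1 L2 = true) (H1 : ∀ m : Fin r, off (modeK m) ≤ m.1 ∧ m.1 < off (modeK m) + krs6 Ψ (modeK m)) (m : Fin r) :
    (jrow6 hV H1 m).1 0 = (Ψ.rowP (sig0 (modeK m)) (sig1 (modeK m)) (sig2 (modeK m)) (sig3 (modeK m)) (m.1 - off (modeK m))).2.1 ∧
    (jrow6 hV H1 m).1 2 = (Ψ.rowP (sig0 (modeK m)) (sig1 (modeK m)) (sig2 (modeK m)) (sig3 (modeK m)) (m.1 - off (modeK m))).2.2.1 ∧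
    (jrow6 hV H1 m).1 4 = (Ψ.rowP (sig0 (modeK m)) (sig1 (modeK m)) (sig2 (modeK m)) (sig3 (modeK m)) (m.1 - off (modeK m))).2.2.2.1 ∧
    (jrow6 hV H1 m).1 6 = (Ψ.rowP (sig0 (modeK m)) (sig1 (modeK m)) (sig2 (modeK m)) (sig3 (modeK m)) (m.1 - off (modeK m))).2.2.2.2 ∧
    (jrow6 hV H1 m).1 0 + (jrow6 hV H1 m).1 1 = sig0 (modeK m) ∧ (jrow6 hV H1 m).1 2 + (jrow6 hV H1 m).1 3 = sig1 (modeK m) ∧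
    (jrow6 hV H1 m).1 4 + (jrow6 hV H1 m).1 5 = sig2 (modeK m) ∧ (jrow6 hV H1 m).1 6 + (jrow6 hV H1 m).1 7 = sig3 (modeK m) :=
  mkRowQ6_val (modeK m) _ (jpivot_box6 hV H1 m).2.1

/-- … and of γ(m). -/
theorem jgam6_val (hV : Ψ.valid L1 L2 = true) (H1 : ∀ m : Fin r, off (modeK m) ≤ m.1 ∧ m.1 < off (modeK m) + krs6 Ψ (modeK m)) (m : Fin r) :
    (jgam6 hV H1 m).1 0 = (Ψ.colP (sig0 (modeK m)) (sig1 (modeK m)) (sig2 (modeK m)) (sig3 (modeK m)) (m.1 - off (modeK m))).1 ∧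
    (jgam6 hV H1 m).1 2 = (Ψ.colP (sig0 (modeK m)) (sig1 (modeK m)) (sig2 (modeK m)) (sig3 (modeK m)) (m.1 - off (modeK m))).2.1 ∧
    (jgam6 hV H1 m).1 4 = (Ψ.colP (sig0 (modeK m)) (sig1 (modeK m)) (sig2 (modeK m)) (sig3 (modeK m)) (m.1 - off (modeK m))).2.2.1 ∧
    (jgam6 hV H1 m).1 6 = (Ψ.colP (sig0 (modeK m)) (sig1 (modeK m)) (sig2 (modeK m)) (sig3 (modeK m)) (m.1 - off (modeK m))).2.2.2 ∧
    sig0 (modeK m) + ((jgam6 hV H1 m).1 0 + (jgam6 hV H1 m).1 1) = 2 ∧ sig1 (modeK m) + ((jgam6 hV H1 m).1 2 + (jgam6 hV H1 m).1 3) = 2 ∧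
    sig2 (modeK m) + ((jgam6 hV H1 m).1 4 + (jgam6 hV H1 m).1 5) = 2 ∧ sig3 (modeK m) + ((jgam6 hV H1 m).1 6 + (jgam6 hV H1 m).1 7) = 2 :=
  mkColQ6_val (modeK m) _ (jpivot_box6 hV H1 m).2.2

/-- U^{lay} on the pivot row of mode m (any layer argument): supported on the modes of the same type, with value A_σ[(lay, h_{ℓ(m)}), ℓ(m')]. -/
theorem JU6_jrow (hV : Ψ.valid L1 L2 = true) (H1 : ∀ m : Fin r, off (modeK m) ≤ m.1 ∧ m.1 < off (modeK m) + krs6 Ψ (modeK m))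
    (lay : ℕ) (m m' : Fin r) :
    JU6 ζ Ψ modeK off lay (jrow6 hV H1 m) m' = if modeK m' = modeK m then
      Z8.eval ζ (Ψ.A (sig0 (modeK m)) (sig1 (modeK m)) (sig2 (modeK m)) (sig3 (modeK m)) lay
        (Ψ.rowP (sig0 (modeK m)) (sig1 (modeK m)) (sig2 (modeK m)) (sig3 (modeK m)) (m.1 - off (modeK m))).2.1
        (Ψ.rowP (sig0 (modeK m)) (sig1 (modeK m)) (sig2 (modeK m)) (sig3 (modeK m)) (m.1 - off (modeK m))).2.2.1
        (Ψ.rowP (sig0 (modeK m)) (sig1 (modeK m)) (sig2 (modeK m)) (sig3 (modeK m)) (m.1 - off (modeK m))).2.2.2.1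
        (Ψ.rowP (sig0 (modeK m)) (sig1 (modeK m)) (sig2 (modeK m)) (sig3 (modeK m)) (m.1 - off (modeK m))).2.2.2.2 (m'.1 - off (modeK m))) else 0 := by
  obtain ⟨e0, e2, e4, e6, p0, p1, p2, p3⟩ := jrow6_val hV H1 m
  unfold JU6
  rw [p0, p1, p2, p3, e0, e2, e4, e6]
  by_cases hk : modeK m' = modeK m
  · rw [if_pos hk, hk, if_pos ⟨rfl, rfl, rfl, rfl⟩]
  · rw [if_neg hk, if_neg]
    intro h
    exact hk (sig_inj _ _ h.1.symm h.2.1.symm h.2.2.1.symm h.2.2.2.symm)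

/-- [U⁰ ; U¹] on the pivot row ρ(m): the value of U^{layer(m)}. -/
theorem JU6_rho (hV : Ψ.valid L1 L2 = true) (H1 : ∀ m : Fin r, off (modeK m) ≤ m.1 ∧ m.1 < off (modeK m) + krs6 Ψ (modeK m)) (m m' : Fin r) :
    Matrix.fromRows (JU6 ζ Ψ modeK off 0) (JU6 ζ Ψ modeK off 1) (jrho6 hV H1 m) m' = if modeK m' = modeK m then
      Z8.eval ζ (Ψ.A (sig0 (modeK m)) (sig1 (modeK m)) (sig2 (modeK m)) (sig3 (modeK m))
        (Ψ.rowP (sig0 (modeK m)) (sig1 (modeK m)) (sig2 (modeK m)) (sig3 (modeK m)) (m.1 - off (modeK m))).1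
        (Ψ.rowP (sig0 (modeK m)) (sig1 (modeK m)) (sig2 (modeK m)) (sig3 (modeK m)) (m.1 - off (modeK m))).2.1
        (Ψ.rowP (sig0 (modeK m)) (sig1 (modeK m)) (sig2 (modeK m)) (sig3 (modeK m)) (m.1 - off (modeK m))).2.2.1
        (Ψ.rowP (sig0 (modeK m)) (sig1 (modeK m)) (sig2 (modeK m)) (sig3 (modeK m)) (m.1 - off (modeK m))).2.2.2.1
        (Ψ.rowP (sig0 (modeK m)) (sig1 (modeK m)) (sig2 (modeK m)) (sig3 (modeK m)) (m.1 - off (modeK m))).2.2.2.2 (m'.1 - off (modeK m))) else 0 := by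
  have hl : (Ψ.rowP (sig0 (modeK m)) (sig1 (modeK m)) (sig2 (modeK m)) (sig3 (modeK m)) (m.1 - off (modeK m))).1 ≤ 1 := (jpivot_box6 hV H1 m).1
  unfold jrho6
  by_cases h0 : (Ψ.rowP (sig0 (modeK m)) (sig1 (modeK m)) (sig2 (modeK m)) (sig3 (modeK m)) (m.1 - off (modeK m))).1 = 0
  · rw [if_pos h0, Matrix.fromRows_apply_inl, JU6_jrow ζ hV H1, h0]
  · have h1 : (Ψ.rowP (sig0 (modeK m)) (sig1 (modeK m)) (sig2 (modeK m)) (sig3 (modeK m)) (m.1 - off (modeK m))).1 = 1 := by omega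
    rw [if_neg h0, Matrix.fromRows_apply_inr, JU6_jrow ζ hV H1, h1]

/-- V on a pivot column: supported on the modes of the same type, with value B_σ[ℓ(m), g_{ℓ(m')}]. -/
theorem JV6_gam (hV : Ψ.valid L1 L2 = true) (H1 : ∀ m : Fin r, off (modeK m) ≤ m.1 ∧ m.1 < off (modeK m) + krs6 Ψ (modeK m)) (m m' : Fin r) :
    JV6 ζ Ψ modeK off m (jgam6 hV H1 m') = if modeK m = modeK m' then
      Z8.eval ζ (Ψ.B (sig0 (modeK m')) (sig1 (modeK m')) (sig2 (modeK m')) (sig3 (modeK m')) (m.1 - off (modeK m'))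
        (Ψ.colP (sig0 (modeK m')) (sig1 (modeK m')) (sig2 (modeK m')) (sig3 (modeK m')) (m'.1 - off (modeK m'))).1
        (Ψ.colP (sig0 (modeK m')) (sig1 (modeK m')) (sig2 (modeK m')) (sig3 (modeK m')) (m'.1 - off (modeK m'))).2.1
        (Ψ.colP (sig0 (modeK m')) (sig1 (modeK m')) (sig2 (modeK m')) (sig3 (modeK m')) (m'.1 - off (modeK m'))).2.2.1
        (Ψ.colP (sig0 (modeK m')) (sig1 (modeK m')) (sig2 (modeK m')) (sig3 (modeK m')) (m'.1 - off (modeK m'))).2.2.2) else 0 := by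
  obtain ⟨e0, e2, e4, e6, p0, p1, p2, p3⟩ := jgam6_val hV H1 m'
  unfold JV6
  by_cases hk : modeK m = modeK m'
  · rw [if_pos hk, hk, p0, p1, p2, p3, e0, e2, e4, e6, if_pos ⟨rfl, rfl, rfl, rfl⟩]
  · rw [if_neg hk, if_neg]
    intro h
    exact hk (sig_inj _ _ (by omega) (by omega) (by omega) (by omega))

/-- LOWER BOUND: rank [M_{δ₁} ; M_{δ₂}] ≥ r. -/
theorem le_jstackRank_of_cert6 [CharZero K] (h4 : ζ ^ 4 = -1) (hV : Ψ.valid L1 L2 = true)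
    (H1 : ∀ m : Fin r, off (modeK m) ≤ m.1 ∧ m.1 < off (modeK m) + krs6 Ψ (modeK m)) (H2 : ∀ k : Fin 19, off k + krs6 Ψ k ≤ r)
    (H3 : ∀ m : Fin r, ∀ k : Fin 19, off k ≤ m.1 → m.1 < off k + krs6 Ψ k → modeK m = k) :
    r ≤ (Matrix.fromRows (ivhsMatrix 6 4 ζ (planeList6q L1)) (ivhsMatrix 6 4 ζ (planeList6q L2))).rank := by
  classical
  set M := Matrix.fromRows (ivhsMatrix 6 4 ζ (planeList6q L1)) (ivhsMatrix 6 4 ζ (planeList6q L2)) with hM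
  set U := Matrix.fromRows (JU6 ζ Ψ modeK off 0) (JU6 ζ Ψ modeK off 1) with hUdef
  have hS : M.submatrix (jrho6 hV H1) (jgam6 hV H1) = U.submatrix (jrho6 hV H1) id * (JV6 ζ Ψ modeK off).submatrix id (jgam6 hV H1) := by
    rw [hM, hUdef, ivhsMatrix_jstack6_eq_mul ζ L1 L2 Ψ modeK off h4 hV H1 H2 H3]
    exact Matrix.submatrix_mul _ _ _ _ _ Function.bijective_id
  -- the left factor of the minor is lower triangular with nonzero diagonal
  have hUt : (U.submatrix (jrho6 hV H1) id).BlockTriangular OrderDual.toDual := by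
    intro m m' hlt
    have hlt' : m < m' := OrderDual.toDual_lt_toDual.mp hlt
    rw [Matrix.submatrix_apply, id_eq, hUdef, JU6_rho ζ hV H1]
    by_cases hk : modeK m' = modeK m
    · rw [if_pos hk]
      obtain ⟨l0, l1, l2, l3⟩ := sig_le (modeK m)
      obtain ⟨hℓ, hℓ'⟩ := modeL_lt_of_lt modeK off (krs6 Ψ) H1 hlt' hk
      rw [KronCert.A_upper_zero hV (by omega) (by omega) (by omega) (by omega) (jmodeL_lt6 H1 m) hℓ' hℓ, Z8.zero_def, Z8.eval_zero]
    · rw [if_neg hk]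
  have hUd : ∀ m : Fin r, (U.submatrix (jrho6 hV H1) id) m m ≠ 0 := by
    intro m
    rw [Matrix.submatrix_apply, id_eq, hUdef, JU6_rho ζ hV H1, if_pos rfl]
    obtain ⟨l0, l1, l2, l3⟩ := sig_le (modeK m)
    exact Z8.eval_ne_zero_of_posConst ζ (KronCert.pivots hV (by omega) (by omega) (by omega) (by omega) (jmodeL_lt6 H1 m)).1
  -- the right factor of the minor is upper triangular with nonzero diagonal
  have hVt : ((JV6 ζ Ψ modeK off).submatrix id (jgam6 hV H1)).BlockTriangular id := by
    intro m m' hlt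
    have hlt' : m' < m := hlt
    rw [Matrix.submatrix_apply, id_eq, JV6_gam ζ hV H1]
    by_cases hk : modeK m = modeK m'
    · rw [if_pos hk]
      obtain ⟨l0, l1, l2, l3⟩ := sig_le (modeK m')
      obtain ⟨hℓ, hℓ'⟩ := modeL_lt_of_lt modeK off (krs6 Ψ) H1 hlt' hk
      rw [KronCert.B_lower_zero hV (by omega) (by omega) (by omega) (by omega) (jmodeL_lt6 H1 m') hℓ' hℓ, Z8.zero_def, Z8.eval_zero]
    · rw [if_neg hk]
  have hVd : ∀ m : Fin r, ((JV6 ζ Ψ modeK off).submatrix id (jgam6 hV H1)) m m ≠ 0 := by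
    intro m
    rw [Matrix.submatrix_apply, id_eq, JV6_gam ζ hV H1, if_pos rfl]
    obtain ⟨l0, l1, l2, l3⟩ := sig_le (modeK m)
    have hBw := Z8.eval_ne_zero_of_posConst ζ (KronCert.pivots hV (by omega) (by omega) (by omega) (by omega) (jmodeL_lt6 H1 m)).2.1
    rw [Z8.eval_mul ζ h4] at hBw
    exact left_ne_zero_of_mul hBw
  have hdet : IsUnit (M.submatrix (jrho6 hV H1) (jgam6 hV H1)).det := by
    rw [hS, Matrix.det_mul, Matrix.det_of_lowerTriangular _ hUt, Matrix.det_of_upperTriangular hVt]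
    exact isUnit_iff_ne_zero.mpr (mul_ne_zero (Finset.prod_ne_zero_iff.mpr fun m _ => hUd m)
      (Finset.prod_ne_zero_iff.mpr fun m _ => hVd m))
  have hrank : (M.submatrix (jrho6 hV H1) (jgam6 hV H1)).rank = r := by
    rw [Matrix.rank_of_isUnit _ ((Matrix.isUnit_iff_isUnit_det _).mpr hdet), Fintype.card_fin]
  calc r = (M.submatrix (jrho6 hV H1) (jgam6 hV H1)).rank := hrank.symm
    _ ≤ M.rank := Matrix.rank_submatrix_le M _ _

/-- MAIN THEOREM (n = 6, stacked, four twisted head pairs): a valid Kronecker stacked certificate with a mode enumeration decides rank [M_{δ₁} ; M_{δ₂}] = r. -/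
theorem ivhsJoinStackRankEq_of_cert6 (L1 L2 : List (ℤ × ℕ × ℕ × ℕ × ℕ)) (Ψ : KronCert) (hV : Ψ.valid L1 L2 = true) {r : ℕ}
    (modeK : Fin r → Fin 19) (off : Fin 19 → ℕ) (H1 : ∀ m : Fin r, off (modeK m) ≤ m.1 ∧ m.1 < off (modeK m) + krs6 Ψ (modeK m))
    (H2 : ∀ k : Fin 19, off k + krs6 Ψ k ≤ r) (H3 : ∀ m : Fin r, ∀ k : Fin 19, off k ≤ m.1 → m.1 < off k + krs6 Ψ k → modeK m = k) :
    ∀ (K : Type) [Field K] [CharZero K] (ζ : K), IsPrimitiveRoot ζ (2 * 4) →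
      (Matrix.fromRows (ivhsMatrix 6 4 ζ (planeList6q L1)) (ivhsMatrix 6 4 ζ (planeList6q L2))).rank = r := by
  intro K _ _ ζ hζ
  have h4 : ζ ^ 4 = -1 := zeta_pow_four_of_primitive hζ
  exact le_antisymm (jstackRank_le_of_cert6 ζ L1 L2 Ψ modeK off h4 hV H1 H2 H3) (le_jstackRank_of_cert6 ζ h4 hV H1 H2 H3)

end cert

end Summit.HodgeConjecture.HodgeConjecture.HodgeLocus.Census.PlaneSum
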